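import Summits.BirchSwinnertonDyer.BirchSwinnertonDyer.Theorems.ErratumRoadFiveNonSurjCornerTwinRubin
import Summits.BirchSwinnertonDyer.Rank1Residual.X5.TwoAdicTargetsMultKatoRat

/-!
# Route `ErratumRoadFive` (rung K2a), crux 6 `NonSurjCorner` (item 19065): the twin's RATIONAL Kato layer is
# the PRIME-UNIFORM multiplicative Kato binder `X5.O1.KatoMultiplicativeDivisibilityRat` (no image hypothesis,
# no Euler-unit certificate) — so the corner's twin summand is `μ = 0` ALONE modulo that binder + Wuthrich Cor. 18
# (cell `bsd-stepL`, seat `bsd-stepL-corner-p1` g5; `--supports stmt-BirchSwinnertonDyer-19065`)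

State of record (g4, `Theorems/ErratumRoadFiveNonSurjCornerTwinRubin.lean`, p463251): on the non-surjective corner
of X11b the rank-`0` Heegner TWIN `E^{d_K}` (`p ∈ {5,7}`, `p ∥ N`, `ρ̄` irreducible NOT onto, no (ram) witness)
needs x11c's typed divisibility `X11b.MultDivisibilityAt` = [Kato's divisibility in `Λ[1/p]`] + [`μ(X(E/ℚ_∞)) = 0`]
(`…TwinMu.lean`, p456176); the rational layer was PRINT only on the EULER-UNIT locus (Rubin 1998 Thm. 8.7 is
`N`-imprimitive: `char X ∣ p^t · ∏_{q∣N} 𝒫_q · L`).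

THIS FILE removes the Euler-unit restriction by reading the rational layer from the PRIME-UNIFORM typed statement
of the `p = 2` cell (`Summits/…/X5/TwoAdicTargetsMultKatoRat.lean`, seat `bsd-2adic-mult`):
`X5.O1.KatoMultiplicativeDivisibilityRat W p` — for EVERY prime `p` of multiplicative reduction, both signs,
NO image hypothesis: `X(E/ℚ_∞)` torsion and `ι g = pⁿ · L` (non-split) resp. `ι(T · g) = pⁿ · L` (split) for some
`g ∈ char_Λ X`, `L` THE `Ω⁺_f`-normalised Mazur–Tate–Teitelbaum function. That cell reduces this binder at every
ODD `p` to Kato's §17.13 inputs at a multiplicative prime (`Kato2004/DivisibilityInputsMultiplicative.lean`: two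
construction facts `Kato2004.exists_multDivisibilityInputs_{nonsplit,split}`, fields = Kato Thm. 12.4 (1),
12.5 (1)–(3), 12.6, 16.6 (2) with §16.1 at `α = a_p = ±1`, (17.13.1)–(17.13.3), Rubin 1998 Prop. A.2 /
Wuthrich 2014 p. 394 / Kobayashi 2006 Thm. 4.1 for the Coleman map; kernel: the tree's PROVED §17.13 module
theory `KatoDivisibilitySkeletonProofs` / `KatoDivisibilityExceptionalZeroSkeletonProofs`), so at `p ∈ {3,5,7}` the
binder is kernel ∘ Literature; here it is consumed BY NAME as a hypothesis shape (nothing asserted).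

* §1 `Λ`-algebra: a nonzero rational period ratio `ϖ = a/(p^e·b')` is absorbed — from `g ∈ char_Λ X` with
  `ι g = pⁿ·L` one gets `C(a)·g ∈ char_Λ X` with `ι(C(a)·g) = p^{n+e}·ϖ·L·ι(C b')`, `C b'` a UNIT of `Λ`
  (`p ∤ b'`): exactly the "imprimitive divisibility with unit Euler constant" shape consumed by g4's
  `mem_charIdeal_of_imprimitive_of_isUnit` / `exists_mem_charIdeal_of_imprimitive_of_isUnit_split`.
* §2 **`multDivisibilityAt_of_katoMultRat_of_integral_of_mu_eq_zero`**: at any `(W, p)`, `p` multiplicative: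
  `KatoMultiplicativeDivisibilityRat W p` + [`ϖ·L ∈ ι(Λ)`, Wuthrich-Cor.-18 shape] + [`μ(X(E/ℚ_∞)) = 0` for every
  cyclotomic dual datum] ⟹ `MultDivisibilityAt W p`; by NAME with Wuthrich 2014 Cor. 18
  (`…_of_corollary18_…`, `p ≠ 2`). NO Euler-unit certificate, NO image hypothesis, NO (ram).
* §3 the corner: **`erratumRoadFive_nonSurjCorner_of_certificates_of_lowerX11a_of_twinKatoMultRat_of_twinMuZero
  : pubs → Cor18 → EulerHalfOffLocus (19062) → X11aLowerHalf (19064) → Zₚᶜ → (∀ leaf twins, KatoMultiplicativeDivisibilityRat)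
  → (∀ leaf twins, μ = 0) → NonSurjCorner`** (p454452 with `hdiv` supplied by §2), and the refined-Kolyvagin
  variant `…_of_refinedKolyvagin_of_lowerX11a_of_twinKatoMultRat_of_twinMuZero` (pubs → 19064 → Zₚᶜ → Jₚᶜ → …).

READING (for the planner ∕ rung K6). After this file the corner's twin summand is EXACTLY Greenberg's `μ = 0` at
the non-surjective X11a leaf twins (rung K6's `KatoMuTransfer` object at `p ∥ N`), modulo (i) the `bsd-2adic` binder
`KatoMultiplicativeDivisibilityRat` at the twins — kernel ∘ {`Kato2004.nonempty_iwasawaH1Data`, `Kato2004.thm12_4`,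
`Kato2004.exists_multDivisibilityInputs_nonsplit/split`, Greenberg 1999 Thm. 1.5} at odd `p` once that cell's
Literature file lands (p474627, review-queued 2026-08-26) — and (ii) Wuthrich 2014 Cor. 18. The Euler-unit
certificate of p463251/p465107 is no longer needed anywhere.

HONEST FRAMING. Theorems only (no `def`, no named fact minted); `KatoMultiplicativeDivisibilityRat` is a
Summits-side `@[conjecture]` def of another cell taken as a HYPOTHESIS (exactly as x11c's `MultDivisibilityAt` was
in p454452); nothing here proves it, `μ = 0`, Zₚᶜ, Jₚᶜ or any pair's BSD; item 19065 does NOT close; no census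
word moves; BSD is not proved by any of this. Flag `Cha05-Rmk25-structure` rides on §3.

References: [Kato2004Asterisque] Thm. 12.4–12.6 (pp. 221–222), Thm. 13.4 (p. 226), §16.1–16.6 (pp. 268–271),
§17.13 (pp. 279–280); [Rubin1998Durham] Thm. 4.1, Prop. 8.3 (i), Thm. 8.7, Prop. A.2; [Wuthrich2014] §3.2
(p. 394), §5 proof of Thm. 16 (p. 398), Cor. 18 (p. 398); [Kobayashi2006DocMath] §3 (p. 572), Thm. 4.1;
[GreenbergLNM1716] Conj. 1.11, §5 (pp. 121–124); [GreenbergVatsal2000] p. 2 (1)–(2); [Washington1997] §13.1;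
tree: `X5/TwoAdicTargetsMultKatoRat.lean` (bsd-2adic), g0–g4's `Theorems/ErratumRoadFiveNonSurjCorner*.lean`.
-/

noncomputable section

open scoped Classical NumberField MatrixGroups ModularForm

namespace Summit.BirchSwinnertonDyer.Rank1Residual.X11b

open CongruenceSubgroup WeierstrassCurve NumberField IsDedekindDomain Field
  Literature.NumberTheory.EllipticCurves
  Literature.NumberTheory.EllipticCurves.ModularForms
  Literature.NumberTheory.EllipticCurves.Rank1Residual
  Literature.NumberTheory.EllipticCurves.Rank1Residual.Typed
  Literature.NumberTheory.EllipticCurves.Wuthrich2014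
  Literature.NumberTheory.EllipticCurves.SteinWuthrich2013
  Literature.NumberTheory.EllipticCurves.GreenbergVatsal2000
  Literature.NumberTheory.QuadraticFields.Quadratic
  Summit.BirchSwinnertonDyer.Rank1Residual
  Summit.BirchSwinnertonDyer.Rank1Residual.X11b.Three.Koly
  Summit.BirchSwinnertonDyer.Rank1Residual.X5.O1

/-! ### §1 Λ-algebra: absorbing a nonzero rational period ratio -/

/-- A natural number prime to `p` is a unit of `ℤ_p` (its `p`-adic norm is `1`). [folklore] -/
theorem isUnit_padicInt_natCast_of_not_dvd {p : ℕ} [Fact p.Prime] {b : ℕ} (hb : ¬ p ∣ b) :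
    IsUnit ((b : ℕ) : ℤ_[p]) := by
  rw [PadicInt.isUnit_iff]
  refine le_antisymm (PadicInt.norm_le_one _) (not_lt.mp fun hlt ↦ hb ?_)
  have hdvd := (PadicInt.norm_int_lt_one_iff_dvd (p := p) (b : ℤ)).mp (by exact_mod_cast hlt)
  exact_mod_cast hdvd

/-- **A nonzero rational is `a / (p^e · b')` with `a ∈ ℤ`, `p ∤ b'`**: `ϖ.num = p^e · b' · ϖ` in `ℚ` with
`ϖ.den = p^e · b'`, `p ∤ b'` (`Nat.exists_eq_pow_mul_and_not_dvd`, `Rat.mul_den_eq_num`). [folklore] -/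
theorem exists_num_eq_pow_mul_mul {p : ℕ} [Fact p.Prime] (ϖ : ℚ) :
    ∃ (e b' : ℕ), ¬ p ∣ b' ∧ (ϖ.num : ℚ) = (p : ℚ) ^ e * (b' : ℚ) * ϖ := by
  obtain ⟨e, b', hb', hden⟩ :=
    Nat.exists_eq_pow_mul_and_not_dvd ϖ.den_nz p (Fact.out : p.Prime).ne_one
  refine ⟨e, b', hb', ?_⟩
  have h := Rat.mul_den_eq_num ϖ
  rw [hden] at h
  push_cast at h
  linear_combination -h

/-- **Non-split shape, rational period ratio absorbed.** If `X` is torsion with `μ(X) = 0`, `g ∈ char_Λ X` with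
`ι g = C(p^n) · L` (the prime-uniform Kato shape), and `ι G = C(ϖ) · L` for a rational `ϖ` (integrality of the
Néron-normalised function), then `G ∈ char_Λ X`. Proof: with `ϖ.num = p^e · b' · ϖ`, `p ∤ b'`, the element
`C(ϖ.num) · g ∈ char_Λ X` satisfies `ι(C(ϖ.num) · g) = C(p^{n+e} · ϖ) · L · ι(C b')` with `C b'` a unit of `Λ` —
g4's `mem_charIdeal_of_imprimitive_of_isUnit` (the power of `p` cancels because `(p) ⊂ ℤ_p⟦T⟧` is prime and
`μ = 0`). [cite: Washington1997, §13.1] [cite: GreenbergVatsal2000, p. 2, (1)–(2)] -/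
theorem mem_charIdeal_of_katoRat_of_integral_of_mu_eq_zero {p : ℕ} [Fact p.Prime]
    {W : WeierstrassCurve ℚ} [W.IsElliptic] {κ : ZpExtension ℚ p} {γ : Field.absoluteGaloisGroup ℚ}
    (hγ : κ.IsTopGenerator γ) (D : W.SelmerDualData κ γ) (hX : D.IsTorsion) (hμ : D.mu = 0)
    {n : ℕ} {g G : IwasawaAlgebra p} {ϖ : ℚ} {L : PowerSeries ℚ_[p]} (hg : g ∈ D.charIdeal)
    (hι : iwasawaToPowerSeries p g = PowerSeries.C ((p : ℚ_[p]) ^ n) * L)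
    (hG : iwasawaToPowerSeries p G = PowerSeries.C ((ϖ : ℚ) : ℚ_[p]) * L) :
    G ∈ D.charIdeal := by
  obtain ⟨e, b', hb', hnum⟩ := exists_num_eq_pow_mul_mul (p := p) ϖ
  have hunit : IsUnit (PowerSeries.constantCoeff (PowerSeries.C ((b' : ℕ) : ℤ_[p]))) := by
    rw [PowerSeries.constantCoeff_C]
    exact isUnit_padicInt_natCast_of_not_dvd hb'
  have hmem : PowerSeries.C ((ϖ.num : ℤ) : ℤ_[p]) * g ∈ D.charIdeal := Ideal.mul_mem_left _ _ hg
  refine mem_charIdeal_of_imprimitive_of_isUnit hγ D hX hμ (t := n + e)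
    (P := PowerSeries.C ((b' : ℕ) : ℤ_[p])) hunit hmem ?_ hG
  -- `ι(C(num) · g) = C(p^{n+e} · ϖ) · L · ι(C b')`
  have hcast : ((ϖ.num : ℤ) : ℚ_[p]) = (p : ℚ_[p]) ^ e * ((b' : ℕ) : ℚ_[p]) * ((ϖ : ℚ) : ℚ_[p]) := by
    have h := congrArg (fun q : ℚ ↦ (q : ℚ_[p])) hnum
    push_cast at h
    exact h
  rw [map_mul, hι, PowerSeries.map_C, PowerSeries.map_C, ← mul_assoc, ← map_mul, mul_assoc,
    mul_comm L, ← mul_assoc, ← map_mul]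
  congr 2
  rw [map_intCast, map_natCast, hcast, pow_add]
  ring

/-- **Split shape, rational period ratio absorbed.** As `mem_charIdeal_of_katoRat_of_integral_of_mu_eq_zero` with
`ι(T · g) = C(p^n) · L` (the prime-uniform split shape, trivial zero charged to the local cohomology) and
`ι G = C(ϖ) · L`: then `G = T · G'` with `G' ∈ char_Λ X`, i.e. `ι(T · G') = C(ϖ) · L` — via g4's
`exists_mem_charIdeal_of_imprimitive_of_isUnit_split`. [cite: Washington1997, §13.1]
[cite: GreenbergVatsal2000, p. 2, (1)–(2)] -/
theorem exists_mem_charIdeal_of_katoRat_of_integral_of_mu_eq_zero_split {p : ℕ} [Fact p.Prime]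
    {W : WeierstrassCurve ℚ} [W.IsElliptic] {κ : ZpExtension ℚ p} {γ : Field.absoluteGaloisGroup ℚ}
    (hγ : κ.IsTopGenerator γ) (D : W.SelmerDualData κ γ) (hX : D.IsTorsion) (hμ : D.mu = 0)
    {n : ℕ} {g G : IwasawaAlgebra p} {ϖ : ℚ} {L : PowerSeries ℚ_[p]} (hg : g ∈ D.charIdeal)
    (hι : iwasawaToPowerSeries p (PowerSeries.X * g) = PowerSeries.C ((p : ℚ_[p]) ^ n) * L)
    (hG : iwasawaToPowerSeries p G = PowerSeries.C ((ϖ : ℚ) : ℚ_[p]) * L) :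
    ∃ G' ∈ D.charIdeal, iwasawaToPowerSeries p (PowerSeries.X * G') = PowerSeries.C ((ϖ : ℚ) : ℚ_[p]) * L := by
  obtain ⟨e, b', hb', hnum⟩ := exists_num_eq_pow_mul_mul (p := p) ϖ
  have hunit : IsUnit (PowerSeries.constantCoeff (PowerSeries.C ((b' : ℕ) : ℤ_[p]))) := by
    rw [PowerSeries.constantCoeff_C]
    exact isUnit_padicInt_natCast_of_not_dvd hb'
  have hmem : PowerSeries.C ((ϖ.num : ℤ) : ℤ_[p]) * g ∈ D.charIdeal := Ideal.mul_mem_left _ _ hg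
  refine exists_mem_charIdeal_of_imprimitive_of_isUnit_split hγ D hX hμ (t := n + e)
    (P := PowerSeries.C ((b' : ℕ) : ℤ_[p])) hunit hmem ?_ hG
  have hcast : ((ϖ.num : ℤ) : ℚ_[p]) = (p : ℚ_[p]) ^ e * ((b' : ℕ) : ℚ_[p]) * ((ϖ : ℚ) : ℚ_[p]) := by
    have h := congrArg (fun q : ℚ ↦ (q : ℚ_[p])) hnum
    push_cast at h
    exact h
  rw [mul_left_comm, map_mul, hι, PowerSeries.map_C, PowerSeries.map_C, ← mul_assoc, ← map_mul, mul_assoc,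
    mul_comm L, ← mul_assoc, ← map_mul]
  congr 2
  rw [map_intCast, map_natCast, hcast, pow_add]
  ring

/-! ### §2 x11c's typed divisibility from the prime-uniform Kato binder + integrality + `μ = 0` -/

/-- **`MultDivisibilityAt W p` from (the prime-uniform multiplicative Kato binder) + (`ϖ · L ∈ ι(Λ)`,
Wuthrich-Cor.-18-shaped) + (`μ(X(E/ℚ_∞)) = 0` for every cyclotomic dual datum).** `hK` is the `p = 2` cell's
typed statement `X5.O1.KatoMultiplicativeDivisibilityRat W p` (no image hypothesis; both signs; `X` torsion
included), taken as a hypothesis; `hint` and `hμ` are hypothesis SHAPES; `hmult` triggers the binder's guard.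
NO Euler-unit certificate (contrast p463251 §3). [cite: Kato2004Asterisque, Thm. 17.4 (1)(2) (p. 273) (shape)]
[cite: Wuthrich2014, Cor. 18 (p. 398) (shape)] [cite: GreenbergLNM1716, §1 Conj. 1.11 (shape of μ = 0)] -/
theorem multDivisibilityAt_of_katoMultRat_of_integral_of_mu_eq_zero (W : WeierstrassCurve ℚ)
    [W.IsElliptic] [W.IsGloballyMinimal] (p : ℕ) [Fact p.Prime] (hmult : Mult W p)
    (hK : KatoMultiplicativeDivisibilityRat W p)
    (hint : ∀ {N : ℕ} [NeZero N] {f : CuspForm (Gamma0 N) 2}, IsNewformOf W f →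
      ∀ (ϖ : ℚ), (ϖ : ℝ) * W.realPeriodRat = plusPeriod f →
        (¬ W.HasSplitMultiplicativeReductionAtPrime p →
          ∀ L : PowerSeries ℚ_[p], IsMultPAdicLFunctionOf f p (-1) L →
            ∃ G : IwasawaAlgebra p, iwasawaToPowerSeries p G = PowerSeries.C ((ϖ : ℚ) : ℚ_[p]) * L) ∧
        (W.HasSplitMultiplicativeReductionAtPrime p →
          ∀ L : PowerSeries ℚ_[p], IsSplitMultPAdicLFunctionOf f p L →
            ∃ G : IwasawaAlgebra p, iwasawaToPowerSeries p G = PowerSeries.C ((ϖ : ℚ) : ℚ_[p]) * L))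
    (hμ : ∀ (κ : ZpExtension ℚ p) (γ : Field.absoluteGaloisGroup ℚ),
      κ.IsCyclotomic → κ.IsTopGenerator γ → IsCyclotomicVariable p γ →
      ∀ D : W.SelmerDualData κ γ, D.mu = 0) :
    MultDivisibilityAt W p := by
  intro κ γ N _ f hκ hγ hγ' hf D ϖ _hϖ0 hϖ
  obtain ⟨hX, hns, hs⟩ := hK κ γ hκ hγ hγ' hmult f hf D
  have hμD : D.mu = 0 := hμ κ γ hκ hγ hγ' D
  refine ⟨hX, fun hn L hL => ?_, fun hsp L hL => ?_⟩
  · obtain ⟨n, g, hg, hι⟩ := hns hn L hL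
    obtain ⟨G, hG⟩ := (hint hf ϖ hϖ).1 hn L hL
    exact ⟨G, mem_charIdeal_of_katoRat_of_integral_of_mu_eq_zero hγ D hX hμD hg hι hG, hG⟩
  · obtain ⟨n, g, hg, hι⟩ := hs hsp L hL
    obtain ⟨G, hG⟩ := (hint hf ϖ hϖ).2 hsp L hL
    exact exists_mem_charIdeal_of_katoRat_of_integral_of_mu_eq_zero_split hγ D hX hμD hg hι hG

/-- **By NAME: `MultDivisibilityAt W p` at an odd multiplicative prime from the prime-uniform Kato binder,
Wuthrich 2014 Cor. 18 and `μ = 0`.** Inputs: `hK : X5.O1.KatoMultiplicativeDivisibilityRat W p` (the `p = 2`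
cell's typed statement; at odd `p` reduced by that cell to Kato's §17.13 inputs at a multiplicative prime —
construction facts `Kato2004.exists_multDivisibilityInputs_{nonsplit,split}`, `Kato2004.thm12_4`,
`Kato2004.nonempty_iwasawaH1Data`, Greenberg 1999 Thm. 1.5); Wuthrich 2014 Cor. 18 (`h18`, named fact:
`ϖ · L ∈ ι(Λ)` at a semistable ordinary `p > 2`, every `E`); `μ(X(E/ℚ_∞)) = 0` for every cyclotomic dual datum
(`hμ`, hypothesis SHAPE — rung K6's object). NO image hypothesis, NO (ram), NO Euler-unit certificate.
CONDITIONAL on `hK`, `h18`, `hμ`; nothing asserted about any particular curve.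
[cite: Wuthrich2014, Cor. 18 (p. 398) with §3.2 (p. 394)] [cite: Kato2004Asterisque, Thm. 17.4 (p. 273), §17.13 (pp. 279–280) (shape)]
[cite: Rubin1998Durham, Prop. A.2 (iii)] [cite: GreenbergLNM1716, §1 Conj. 1.11 (shape of μ = 0)] -/
theorem multDivisibilityAt_of_katoMultRat_of_corollary18_of_mu_eq_zero
    (h18 : Wuthrich2014.corollary18_padicLFunction_mem_iwasawaAlgebra_multiplicative)
    (W : WeierstrassCurve ℚ) [W.IsElliptic] [W.IsGloballyMinimal] (p : ℕ) [Fact p.Prime]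
    (hp : p ≠ 2) (hmult : Mult W p) (hK : KatoMultiplicativeDivisibilityRat W p)
    (hμ : ∀ (κ : ZpExtension ℚ p) (γ : Field.absoluteGaloisGroup ℚ),
      κ.IsCyclotomic → κ.IsTopGenerator γ → IsCyclotomicVariable p γ →
      ∀ D : W.SelmerDualData κ γ, D.mu = 0) :
    MultDivisibilityAt W p :=
  multDivisibilityAt_of_katoMultRat_of_integral_of_mu_eq_zero W p hmult hK
    (fun hf ϖ hϖ ↦ h18 W p hp hmult hf ϖ hϖ) hμ

/-! ### §3 The corner: the twin summand is `μ = 0` modulo the prime-uniform binder at the leaf twins -/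

/-- **`NonSurjCorner` modulo print + Wuthrich 2014 Cor. 18 + EulerHalfOffLocus (19062) + X11aLowerHalf (19064) +
Zₚᶜ + [the prime-uniform Kato binder `KatoMultiplicativeDivisibilityRat` at the leaf twins] + [`μ = 0` at the leaf
twins]** — p454452's `erratumRoadFive_nonSurjCorner_of_certificates_of_lowerX11a_of_twinMultDivisibility` with its
binder `hdiv` (x11c's `MultDivisibilityAt` on the non-surjective X11a leaf at `p ∈ {5,7}`) supplied by §2. Compared
with p463251 §4: NO Euler-unit certificate and NO typed divisibility off the Euler-unit locus — at EVERY leaf twin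
the Euler-system half is (binder) + Cor. 18 + `μ = 0`. PUBLISHED binders as in p454452 plus `h18`. CONDITIONAL on
`h₂`, `h₄`, `hZ`, `hK`, `hμ`; does NOT close item 19065; nothing booked.
[cite: Kato2004Asterisque, Thm. 17.4 (p. 273), §17.13 (pp. 279–280) (shape of hK)] [cite: Wuthrich2014, Cor. 18 (p. 398)]
[cite: Cha2005, Rmk. 25 (p. 175)] [cite: MatarNekovar2019, Thm. 0.3, §0.9, §0.11 (pp. 456–457)]
[cite: WZhang2014, Thm. 1.1 and Rem. 5 (shape of Zₚᶜ)] [cite: SteinWuthrich2013, Thm. 6.1 (p. 20)]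
[cite: JetchevSkinnerWan2017, §7.4.1–7.4.2 (pp. 30–31)] [cite: GreenbergLNM1716, §1 Conj. 1.11 (shape of μ = 0)] -/
theorem erratumRoadFive_nonSurjCorner_of_certificates_of_lowerX11a_of_twinKatoMultRat_of_twinMuZero
    (hGZ : ∀ (N : ℕ) [NeZero N] (W : WeierstrassCurve ℚ) (K : Type) [Field K] [NumberField K],
      gross_zagier N W K)
    (hKo : ∀ (N : ℕ) [NeZero N] (W : WeierstrassCurve ℚ) (K : Type) [Field K] [NumberField K],
      kolyvagin N W K)
    (hWu : sha_dvd_analyticSha)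
    (hMN : ∀ (N : ℕ) [NeZero N] (W : WeierstrassCurve ℚ) (K : Type) [Field K] [NumberField K],
      MatarNekovar2019.thm03_padicValNat_card_sha_le_of_irreducible N W K)
    (hGZK : rank_eq_analyticRank_of_analyticRank_le_one) (hmod : hasEntireLFunction_rat)
    (hnf : exists_isNewformOf) (hpar : nonempty_modularParametrizationData)
    (hFHs : friedbergHoffstein_exists_heegnerField_split_twist_ne_zero)
    (hMaz : mazur_not_dvd_maninConstant_of_odd)
    (hrec : ∀ (N : ℕ) [NeZero N] (W : WeierstrassCurve ℚ) (K : Type) [Field K] [NumberField K],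
      heegnerPointOfConductor_one_galoisConj N W K)
    (hD36 : ∀ (N : ℕ) [NeZero N] (W : WeierstrassCurve ℚ) (K : Type) [Field K] [NumberField K],
      phi_heegnerTau_mem_singularModuliField N W K)
    (hJs : thm61_splitMultiplicative) (hJn : thm61_nonsplitMultiplicative)
    (hGS : ∀ (W : WeierstrassCurve ℚ) [W.IsElliptic] [W.IsGloballyMinimal] (p : ℕ) [Fact p.Prime],
      greenberg_stevens (W := W) (p := p))
    (hChaL : Cha2005.rmk25_pow_dvd_card_sha_primary_of_certificate)
    -- the one named fact beyond p454452
    (h18 : Wuthrich2014.corollary18_padicLFunction_mem_iwasawaAlgebra_multiplicative)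
    (h₂ : Summit.BirchSwinnertonDyer.BirchSwinnertonDyer.Theses.ErratumRoadFive.EulerHalfOffLocus)
    (h₄ : Summit.BirchSwinnertonDyer.BirchSwinnertonDyer.Theses.ErratumRoadFive.X11aLowerHalf)
    -- Zₚᶜ: certificates on corner frames (`M_∞ ≤ t`)
    (hZ : ∀ (W : WeierstrassCurve ℚ) [W.IsElliptic] [W.IsGloballyMinimal] (p : ℕ) [Fact p.Prime]
      (N : ℕ) [NeZero N] (K : Type) [Field K] [NumberField K]
      (Dt : ModularParametrizationData W N) (β : ℤ) (ι : K →+* ℂ),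
      ClassX11b W p → ¬ Surj W p → (p = 5 ∨ p = 7) → p ∣ padicValInt p W.minimalDiscriminantInt →
      ¬ Ram W p → W.conductorNorm ℤ = N → IsImaginaryQuadratic K →
      4 < (NumberField.discr K).natAbs → SatisfiesHeegnerHypothesis N K →
      SatisfiesHeegnerHypothesis p K → (4 * (N : ℤ)) ∣ β ^ 2 - NumberField.discr K → ¬ (p : ℤ) ∣ Dt.c →
      ∃ M : ℕ, M ≤ padicValNat p W.tamagawaProduct ∧ CertificateAt Dt β ι p M)
    -- the prime-uniform multiplicative Kato binder at the leaf twins (bsd-2adic's typed statement, hypothesis)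
    (hK : ∀ (Wd : WeierstrassCurve ℚ) [Wd.IsElliptic] [Wd.IsGloballyMinimal] (p : ℕ) [Fact p.Prime],
      ClassX11a Wd p → ¬ Surj Wd p → (p = 5 ∨ p = 7) → p ∣ padicValInt p Wd.minimalDiscriminantInt →
      KatoMultiplicativeDivisibilityRat Wd p)
    -- Greenberg's μ = 0 at the leaf twins (rung K6's object; hypothesis shape)
    (hμ : ∀ (Wd : WeierstrassCurve ℚ) [Wd.IsElliptic] [Wd.IsGloballyMinimal] (p : ℕ) [Fact p.Prime],
      ClassX11a Wd p → ¬ Surj Wd p → (p = 5 ∨ p = 7) → p ∣ padicValInt p Wd.minimalDiscriminantInt →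
      ∀ (κ : ZpExtension ℚ p) (γ : Field.absoluteGaloisGroup ℚ),
        κ.IsCyclotomic → κ.IsTopGenerator γ → IsCyclotomicVariable p γ →
        ∀ D : Wd.SelmerDualData κ γ, D.mu = 0) :
    Summit.BirchSwinnertonDyer.BirchSwinnertonDyer.Theses.ErratumRoadFive.NonSurjCorner :=
  erratumRoadFive_nonSurjCorner_of_certificates_of_lowerX11a_of_twinMultDivisibility hGZ hKo hWu hMN hGZK
    hmod hnf hpar hFHs hMaz hrec hD36 hJs hJn hGS hChaL h₂ h₄ hZ
    (fun Wd _ _ p _ hXa hnsd h57 hvd ↦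
      multDivisibilityAt_of_katoMultRat_of_corollary18_of_mu_eq_zero h18 Wd p hXa.2.1 hXa.2.2.1
        (hK Wd p hXa hnsd h57 hvd) (hμ Wd p hXa hnsd h57 hvd))

/-- **`NonSurjCorner` modulo print + Wuthrich 2014 Cor. 18 + X11aLowerHalf (19064) + Zₚᶜ + Jₚᶜ + [the prime-uniform
Kato binder at the leaf twins] + [`μ = 0` at the leaf twins] — NO `EulerHalfOffLocus`.** p454452's
`erratumRoadFive_nonSurjCorner_of_refinedKolyvagin_of_lowerX11a_of_twinMultDivisibility` with `hdiv` supplied by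
§2. CONDITIONAL on `h₄`, `hZ`, `hJ`, `hK`, `hμ`; does NOT close item 19065; nothing booked.
[cite: Cha2005, Thm. 21 and Rmk. 25 (pp. 173–175)] [cite: MatarNekovar2019, Thm. 0.7, §0.9, §0.11 (pp. 456–457)]
[cite: McCallumLMS1991, §5 Cor. 5.6 (p. 310)] [cite: WZhang2014, Thm. 1.1 and Rem. 5 (shape of Zₚᶜ)]
[cite: Jetchev2008, Conj. 1.3 (shape of Jₚᶜ)] [cite: Wuthrich2014, Cor. 18 (p. 398)]
[cite: Kato2004Asterisque, Thm. 17.4 (p. 273) (shape of hK)] [cite: GreenbergLNM1716, §1 Conj. 1.11 (shape of μ = 0)] -/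
theorem erratumRoadFive_nonSurjCorner_of_refinedKolyvagin_of_lowerX11a_of_twinKatoMultRat_of_twinMuZero
    (hGZ : ∀ (N : ℕ) [NeZero N] (W : WeierstrassCurve ℚ) (K : Type) [Field K] [NumberField K],
      gross_zagier N W K)
    (hKo : ∀ (N : ℕ) [NeZero N] (W : WeierstrassCurve ℚ) (K : Type) [Field K] [NumberField K],
      kolyvagin N W K)
    (hWu : sha_dvd_analyticSha)
    (hGZK : rank_eq_analyticRank_of_analyticRank_le_one) (hmod : hasEntireLFunction_rat)
    (hnf : exists_isNewformOf) (hpar : nonempty_modularParametrizationData)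
    (hFHs : friedbergHoffstein_exists_heegnerField_split_twist_ne_zero)
    (hMaz : mazur_not_dvd_maninConstant_of_odd)
    (hrec : ∀ (N : ℕ) [NeZero N] (W : WeierstrassCurve ℚ) (K : Type) [Field K] [NumberField K],
      heegnerPointOfConductor_one_galoisConj N W K)
    (hD36 : ∀ (N : ℕ) [NeZero N] (W : WeierstrassCurve ℚ) (K : Type) [Field K] [NumberField K],
      phi_heegnerTau_mem_singularModuliField N W K)
    (hJs : thm61_splitMultiplicative) (hJn : thm61_nonsplitMultiplicative)
    (hGS : ∀ (W : WeierstrassCurve ℚ) [W.IsElliptic] [W.IsGloballyMinimal] (p : ℕ) [Fact p.Prime],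
      greenberg_stevens (W := W) (p := p))
    (hChaL : Cha2005.rmk25_pow_dvd_card_sha_primary_of_certificate)
    (hChaU : Cha2005.rmk25_padicValNat_card_sha_primary_add_le_of_globalDivisibility)
    (h18 : Wuthrich2014.corollary18_padicLFunction_mem_iwasawaAlgebra_multiplicative)
    (h₄ : Summit.BirchSwinnertonDyer.BirchSwinnertonDyer.Theses.ErratumRoadFive.X11aLowerHalf)
    -- Zₚᶜ: certificates on corner frames (`M_∞ ≤ t`)
    (hZ : ∀ (W : WeierstrassCurve ℚ) [W.IsElliptic] [W.IsGloballyMinimal] (p : ℕ) [Fact p.Prime]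
      (N : ℕ) [NeZero N] (K : Type) [Field K] [NumberField K]
      (Dt : ModularParametrizationData W N) (β : ℤ) (ι : K →+* ℂ),
      ClassX11b W p → ¬ Surj W p → (p = 5 ∨ p = 7) → p ∣ padicValInt p W.minimalDiscriminantInt →
      ¬ Ram W p → W.conductorNorm ℤ = N → IsImaginaryQuadratic K →
      4 < (NumberField.discr K).natAbs → SatisfiesHeegnerHypothesis N K →
      SatisfiesHeegnerHypothesis p K → (4 * (N : ℤ)) ∣ β ^ 2 - NumberField.discr K → ¬ (p : ℤ) ∣ Dt.c →
      ∃ M : ℕ, M ≤ padicValNat p W.tamagawaProduct ∧ CertificateAt Dt β ι p M)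
    -- Jₚᶜ: the Jetchev direction on corner frames (`M_∞ ≥ t`)
    (hJ : ∀ (W : WeierstrassCurve ℚ) [W.IsElliptic] [W.IsGloballyMinimal] [NeZero (W.conductorNorm ℤ)]
      (p : ℕ) [Fact p.Prime] (K : Type) [Field K] [NumberField K]
      (Dt : ModularParametrizationData W (W.conductorNorm ℤ)) (β : ℤ) (ι : K →+* ℂ),
      ClassX11b W p → ¬ Surj W p → (p = 5 ∨ p = 7) → p ∣ padicValInt p W.minimalDiscriminantInt →
      ¬ Ram W p → IsImaginaryQuadratic K → 4 < (NumberField.discr K).natAbs →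
      SatisfiesHeegnerHypothesis (W.conductorNorm ℤ) K → SatisfiesHeegnerHypothesis p K →
      (4 * (W.conductorNorm ℤ : ℤ)) ∣ β ^ 2 - NumberField.discr K → ¬ (p : ℤ) ∣ Dt.c →
      ∀ (s : ℕ), s ≤ padicValNat p W.tamagawaProduct →
        ∀ (n : ℕ) (d : KolyvaginHeegnerData Dt β ι n), Squarefree n →
          (∀ ℓ ∈ n.primeFactors, Zhang2014.IsKolyvaginPrime (W.conductorNorm ℤ) W K p ℓ ∧
            s ≤ Zhang2014.kolyvaginIndex W p ℓ) → PDiv d p s)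
    -- the prime-uniform multiplicative Kato binder at the leaf twins (bsd-2adic's typed statement, hypothesis)
    (hK : ∀ (Wd : WeierstrassCurve ℚ) [Wd.IsElliptic] [Wd.IsGloballyMinimal] (p : ℕ) [Fact p.Prime],
      ClassX11a Wd p → ¬ Surj Wd p → (p = 5 ∨ p = 7) → p ∣ padicValInt p Wd.minimalDiscriminantInt →
      KatoMultiplicativeDivisibilityRat Wd p)
    -- Greenberg's μ = 0 at the leaf twins (rung K6's object; hypothesis shape)
    (hμ : ∀ (Wd : WeierstrassCurve ℚ) [Wd.IsElliptic] [Wd.IsGloballyMinimal] (p : ℕ) [Fact p.Prime],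
      ClassX11a Wd p → ¬ Surj Wd p → (p = 5 ∨ p = 7) → p ∣ padicValInt p Wd.minimalDiscriminantInt →
      ∀ (κ : ZpExtension ℚ p) (γ : Field.absoluteGaloisGroup ℚ),
        κ.IsCyclotomic → κ.IsTopGenerator γ → IsCyclotomicVariable p γ →
        ∀ D : Wd.SelmerDualData κ γ, D.mu = 0) :
    Summit.BirchSwinnertonDyer.BirchSwinnertonDyer.Theses.ErratumRoadFive.NonSurjCorner :=
  erratumRoadFive_nonSurjCorner_of_refinedKolyvagin_of_lowerX11a_of_twinMultDivisibility hGZ hKo hWu hGZK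
    hmod hnf hpar hFHs hMaz hrec hD36 hJs hJn hGS hChaL hChaU h₄ hZ hJ
    (fun Wd _ _ p _ hXa hnsd h57 hvd ↦
      multDivisibilityAt_of_katoMultRat_of_corollary18_of_mu_eq_zero h18 Wd p hXa.2.1 hXa.2.2.1
        (hK Wd p hXa hnsd h57 hvd) (hμ Wd p hXa hnsd h57 hvd))

end Summit.BirchSwinnertonDyer.Rank1Residual.X11b

end
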